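/-
Copyright (c) 2026 the pub-hodgecm-mathlib formalisation cell (harness21).  Prover seat hodgecm-mathlib-K2E3-p28 (g3) (E3 hand lent to strike line L1 by CHAIR K2-lead (g2)
VALVE WORD W4; LEAD F0P6-plan (g14) BATCH #160 (3) «U1∕#41-shared (o1)-PLACE LETTERS OF RECORD»; desk K2E3-p14 (g9) ∕ K2E5-p16 (g8)), Track B «K2-LIT» ∕
hLiu418 = stmt-HodgeConjecture-24832: ★ G1's eleven letters `T νv hνK νinf hmap hχ hfac hh hw hS hG` PRODUCED at `(f, S, h)` for a STANDARD continuous family `f` — the ONE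
instantiation both U1-glob's `htail` (★ B2b FILE 2) and K1-a♮'s `hhead` road consume.  THEOREMS ONLY.  Template of record: ★ (E3) `K2LiuBigCellEulerHead` (index `0`).
-/
import Summits.HodgeConjecture.HodgeConjecture.Theorems.K2LiuBigCellEulerHead                      -- ★ (E3) (K2Liu-p13): the index-0 assembly + its ★ inputs (#31s, Φ3a, S4-good, O41.3, Φ3b, `exists_finset_evalPlace_mem_localInt`)
import Summits.HodgeConjecture.HodgeConjecture.Theorems.K2LiuWhittakerDeltaEulerProduct             -- ★ G1 (K2Liu-p12): `whittakerDelta_eq_mul_tprod_euler`; brings ★ (d1) `exists_finset_forall_integral`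
import Summits.HodgeConjecture.HodgeConjecture.Theorems.K2LiuSiegelEisensteinKindWGlobalIntegrable  -- ★ (x-c): `integrable_conj_unipDeltaChar_mul` (`hG` at any index)
import Summits.HodgeConjecture.HodgeConjecture.Theorems.K2LiuKindWCarrierOfRecord                    -- ★ (KW-car) (K2E4-p11): `exists_kindW_carrierLetters` (`νv hνK νinf hmap hχ` for any Haar `νN`)
import HarnessLib

/-!
# Crux `HLiu418`, socket #41 ∕ organ U1-CT-ind stage 3 — THE (o1)-PLACE LETTERS OF RECORD: ★ G1's letters at `(f, S, h)` for a STANDARD continuous family,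
# and ★ G1 APPLIED there: `W_S(f_s)(h) = HEAD_T(f ∘ placesEmbed_T) · ∏'_{v∉T} W°_{S,v}(s)` for every `T ⊇ T₀(𝒦, χ, f, h, S)`   [KudlaRallis1994 §1–§2; Tan1999 §2–§3]

Cell `hodgecm-mathlib`, crux item hLiu418 = `stmt-HodgeConjecture-24832`; squad K2, LEAD F0P6-plan (g14) (BATCH #160 (3)); desk K2E3-p14 (g9) ∕ K2E5-p16 (g8); box K2E5-r02;
prover K2E3-p28 (g3).  Lane `--supports stmt-HodgeConjecture-24832 --as helper` (count-neutral).  THEOREMS ONLY (no `def`, no `instance`, no notation, no named-fact hypothesis,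
no `sorry`).  General frame `e : Fin N × Fin M ≃ Fin n`, general index `S : Matrix (Fin n) (Fin n) L`, any Hecke character `χ` (unitary only where ★ O41.3 needs it).

THE POINT.  ★ G1 `K2LiuWhittakerDeltaEulerProduct.whittakerDelta_eq_mul_tprod_euler` takes ELEVEN letters BY VALUE: the place set `T`, the carriers `νv hνK νinf hmap`, `χ`
unramified off `T` (`hχ`), the factorisation `hfac : IsFactorizableOff T χ f fT`, the integrality guards `hh hw` (`h_v, (w_Δ)_v ∈ K_{H,v}` off `T`), `hS` (entries of `S` integral
above `v ∉ T`) and `hG` (the twisted integrand is `L¹(νN)`).  Two consumers need them at the SAME data — a STANDARD Iwasawa datum `𝒦`, a `𝒦`-standard family `f` with continuous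
members, a point `h`, an index `S`: U1-glob's `htail` (★ B2b FILE 2 `K2LiuSingularWhittakerPlaceFactorEuler`, which re-runs ★ G1 with the head pure at `v₀`) and K1-a♮'s `hhead`
road (K2E3-p14 (g9) LEVEL-2 table §B; LEAD BATCH #157 (3) ∕ #160 (3)).  Of the eleven: `νv hνK νinf hmap hχ` are ★ (KW-car) `exists_kindW_carrierLetters` for ANY Haar `νN`
(one `obtain`); `hG` is ★ (x-c) `integrable_conj_unipDeltaChar_mul` (one line, `χ` unitary, `n∕2 < re s`); this file produces the remaining FIVE, which depend on `(𝒦, f, h, S)`,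
exactly as the index-`0` template ★ (E3) `K2LiuBigCellEulerHead.exists_eulerHead_intertwiningDelta` does — and then applies ★ G1:
* §1 **`exists_placeLetters_of_isStandard`** — `∃ T₀, ∀ T ⊇ T₀`: (`hχ`) `χ` unramified at every place of `L` above `v ∉ T` (★ `isUnramifiedAt_cofinite`); (`hfac`)
  `IsFactorizableOff T χ f (fun s x => f s (placesEmbed_T x))` — ★ #31s `stdFamilyFactorisable` fed by ★ Φ3a `exists_finset_level_of_isStandardSectionFamily` (level + right
  invariance at one parameter) and ★ (S4-good) `eventually_forall_exists_siegelDelta_mul_localInt` (local Iwasawa off a finite set); (`hh`, `hw`) ★ (E3)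
  `exists_finset_evalPlace_mem_localInt` at `h` and at `w_Δ`; (`hS`) ★ (d1) `exists_finset_forall_integral`.  `T₀` := the union of the six guards; everything is MONOTONE in `T`,
  so U1 takes `T := T₀ ∪ {v₀}` and #41 takes its own `T ⊇ T₀`.
* §2 **`exists_eulerHead_whittakerDelta_of_isStandard`** — the index-`S` twin of ★ (E3): for every `T ⊇ T₀`, every Haar `νN`, local carriers `νv` pinned off `T` and archimedean
  carrier `ν_∞` with the splitting `hmap` BY VALUE (★ Φ3b ∕ ★ (KW-car) give them; so a caller of ★ FILE 2 re-uses the same `ν_∞`) — on `n∕2 < re s` (`χ` unitary),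
  `W_S(f_s)(h) = (∫ [conj ψ_S(p_∞)·∏_{v∈T} conj ψ_S(ι_v p_v)] · f_s(placesEmbed_T(w_Δ p_∞ h_∞, (w_{Δ,v} p_v h_v)_{v∈T})) d(ν_∞ ⊗ ⨂_{v∈T} ν_v)) · ∏'_{v∉T} ∫ conj ψ_S(ι_v y)·Λ_{s,v}(w_Δ y) dν_v(y)`
  — ★ G1 with every data-dependent letter discharged by name (§1 + ★ (x-c)); desk K2E3-p14 (g9) 23:49:39Z «split»: carriers by value keep the statement in ★ G1's 800 000 class.
References: [KudlaRallis1994] S. Kudla, S. Rallis, Ann. of Math. 140 (1994), §1–§2; [Tan1999] V. Tan, Canad. J. Math. 51 (1999), §2–§3; [Liu2011] Y. Liu, Algebra Number Theory 5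
(2011), §2B p. 862; [BorelJacquet1979] §4.1; [CasselsFrohlichANT1967] Ch. XV (Tate) §3.1–§3.3.
HONEST LABEL.  Count-neutral helper: `HC_CM` is proved only modulo the 7 printed citations (2 remaining named inputs: hLiu418 = `stmt-HodgeConjecture-24832`,
h413 = `stmt-HodgeConjecture-24833`) until rung 0 closes; it instantiates letters, it closes no socket.
-/

set_option autoImplicit false
set_option linter.dupNamespace false -- the mandated namespace repeats `HodgeConjecture.HodgeConjecture`

noncomputable section

open scoped Matrix RestrictedProduct ENNReal NNReal Topology ComplexConjugate
open NumberField IsDedekindDomain MeasureTheory Measure Filter Set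

namespace Summit.HodgeConjecture.HodgeConjecture.Cruxes.HLiu418.K2LiuStdSectionPlaceLettersOfRecord

open Literature.NumberTheory.Automorphic Literature.NumberTheory.GaloisRepresentations
open Literature.NumberTheory.GelbartRogawski1991 Literature.NumberTheory.GelbartRogawski1991.GRConstruction
open Literature.NumberTheory.K2Lit.SiegelDoubled
open Literature.NumberTheory.K2Lit.PlaceSplitting
open Literature.MeasureTheory.RestrictedProduct
open Literature.Topology.Algebra.RestrictedProduct (inH)
open Summit.HodgeConjecture.HodgeConjecture.Cruxes.HLiu418.K2LiuSiegelUnipotentLocalDefs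
open Summit.HodgeConjecture.HodgeConjecture.Cruxes.HLiu418.K2LiuSiegelUnipotentSplitDefs
open Summit.HodgeConjecture.HodgeConjecture.Cruxes.HLiu418.K2LiuSiegelUnipotentSplitAtDefs
open Summit.HodgeConjecture.HodgeConjecture.Cruxes.HLiu418.K2LiuSiegelUnipotentHaarPinned
open Summit.HodgeConjecture.HodgeConjecture.Cruxes.HLiu418.K2LiuSiegelUnipotentFourierDefs
open Summit.HodgeConjecture.HodgeConjecture.Cruxes.HLiu418.K2LiuWhittakerDeltaEulerProduct (whittakerDelta_eq_mul_tprod_euler)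
open Summit.HodgeConjecture.HodgeConjecture.Cruxes.HLiu418.K2LiuSiegelUnipotentCharacterFactorisation (exists_finset_forall_integral)
open Summit.HodgeConjecture.HodgeConjecture.Cruxes.HLiu418.K2LiuSiegelEisensteinKindWGlobalIntegrable (integrable_conj_unipDeltaChar_mul)
open Summit.HodgeConjecture.HodgeConjecture.Cruxes.HLiu418.K2LiuBigCellEulerHead (exists_finset_evalPlace_mem_localInt)
open Summit.HodgeConjecture.HodgeConjecture.Cruxes.HLiu418.K2LiuStdFamilyFactorisable (stdFamilyFactorisable)
open Summit.HodgeConjecture.HodgeConjecture.Cruxes.HLiu418.K2LiuStdDatumLevelOffS (exists_finset_level_of_isStandardSectionFamily)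
open Summit.HodgeConjecture.HodgeConjecture.Cruxes.HLiu418.K2LiuSWGeneratorGoodPlaces (eventually_forall_exists_siegelDelta_mul_localInt)

variable (L : Type) [Field L] [NumberField L] [IsCMField L]
variable {N M n : ℕ} (e : Fin N × Fin M ≃ Fin n)
  (dV : Fin N → L) (hdV : ∀ i, IsCMField.complexConj L (dV i) = dV i)
  (dW : Fin M → L) (hdW : ∀ i, IsCMField.complexConj L (dW i) = dW i)
  [DecidableEq (HeightOneSpectrum (𝓞 (Fp L)))]

/-! ## §1 The five `(𝒦, f, h, S)`-dependent letters of ★ G1, off ONE finite `T₀` -/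

set_option maxHeartbeats 800000 in -- MEASURED class of the template ★ (E3) `exists_eulerHead_intertwiningDelta` (★ #31s on the doubled datum's binder telescope: `whnf` of the statement); `obtain`∕`exact` only
/-- **THE (o1)-PLACE LETTERS OF RECORD.**  `𝒦` standard, `f` a `𝒦`-standard family with continuous members, `h ∈ H(𝔸)`, `S ∈ M_n(L)`.  There is a finite `T₀` such that for every
finite `T ⊇ T₀`: (`hχ`) `χ` is unramified at every place above `v ∉ T`; (`hfac`) `f` FACTORISES OFF `T` through its own slice values `fT s x := f s (placesEmbed_T x)` (★ #31s);
(`hh`) `h_v ∈ K_{H,v}`, (`hw`) `(w_Δ)_v ∈ K_{H,v}`, and (`hS`) every entry of `S` is integral above `v`, for all `v ∉ T` — ★ G1's five data-dependent letters at `(f, S, h)`.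
[cite: Tan1999, §1 p. 166; §3] [cite: Liu2011, §2B p. 862] [cite: BorelJacquet1979, §4.1] [cite: CasselsFrohlichANT1967, Ch. XV (Tate) §3.1, Lemma 3.2.1] -/
theorem exists_placeLetters_of_isStandard (hdV0 : ∀ i, dV i ≠ 0) (hdW0 : ∀ i, dW i ≠ 0)
    {𝒦 : IwasawaDatum L e dV hdV dW hdW} (h𝒦 : 𝒦.IsStd) {χ : HeckeCharacter L}
    {f : ℂ → HA L e dV hdV dW hdW → ℂ} (hstd : IsStandardSectionFamily 𝒦 χ f) (hcont : ∀ s, Continuous (f s)) (h : HA L e dV hdV dW hdW)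
    (S : Matrix (Fin n) (Fin n) L) :
    ∃ T₀ : Finset (HeightOneSpectrum (𝓞 (Fp L))), ∀ T : Finset (HeightOneSpectrum (𝓞 (Fp L))), T₀ ⊆ T →
      (∀ v, v ∉ T → ∀ w' : UnitaryGroup.PlacesOver L v, χ.IsUnramifiedAt w'.1) ∧
      IsFactorizableOff L e dV hdV dW hdW T χ f (fun s x => f s (placesEmbed L (hermD L e dV hdV dW hdW) T x)) ∧
      (∀ v, v ∉ T → UnitaryGroup.evalPlace (Fp L) L (IsCMField.complexConj L) (n + n) (hermD L e dV hdV dW hdW) v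
        (UnitaryGroup.finPart (Fp L) L (IsCMField.complexConj L) (n + n) (hermD L e dV hdV dW hdW) h) ∈
          UnitaryGroup.localInt L (IsCMField.complexConj L) (n + n) (hermD L e dV hdV dW hdW) v) ∧
      (∀ v, v ∉ T → UnitaryGroup.evalPlace (Fp L) L (IsCMField.complexConj L) (n + n) (hermD L e dV hdV dW hdW) v
        (UnitaryGroup.finPart (Fp L) L (IsCMField.complexConj L) (n + n) (hermD L e dV hdV dW hdW) (weylDelta L e dV hdV dW hdW)) ∈
          UnitaryGroup.localInt L (IsCMField.complexConj L) (n + n) (hermD L e dV hdV dW hdW) v) ∧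
      (∀ v, v ∉ T → ∀ (w : UnitaryGroup.PlacesOver L v) (i j : Fin n), ((S i j : L) : w.1.adicCompletion L) ∈ w.1.adicCompletionIntegers L) := by
  -- the six cofinite guards: level (★ Φ3a), `χ` unramified, local Iwasawa (★ S4-good), `h_v ∈ K_{H,v}`, `(w_Δ)_v ∈ K_{H,v}`, `S` integral (★ (d1))
  obtain ⟨S₁, hS₁⟩ := exists_finset_level_of_isStandardSectionFamily L e dV hdV dW hdW h𝒦 hstd hcont 0
  obtain ⟨T₂, hT₂⟩ : ∃ T₂ : Finset (HeightOneSpectrum (𝓞 (Fp L))), ∀ v ∉ T₂, ∀ w : UnitaryGroup.PlacesOver L v, χ.IsUnramifiedAt w.1 :=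
    ⟨(Filter.eventually_cofinite.1 (UnitaryGroup.eventually_forall_placesOver (F := Fp L) L (Q := fun w => χ.IsUnramifiedAt w)
        (HeckeCharacter.isUnramifiedAt_cofinite_holds χ))).toFinset,
      fun v hv => by
        by_contra h1
        exact hv ((Set.Finite.mem_toFinset _).2 h1)⟩
  obtain ⟨T₃, hT₃⟩ : ∃ T₃ : Finset (HeightOneSpectrum (𝓞 (Fp L))), ∀ v ∉ T₃, ∀ x : UnitaryGroup.localPi L (IsCMField.complexConj L) (n + n) (hermD L e dV hdV dW hdW) v,
      ∃ p ∈ siegelDeltaLoc L e dV hdV dW hdW v, ∃ k ∈ UnitaryGroup.localInt L (IsCMField.complexConj L) (n + n) (hermD L e dV hdV dW hdW) v, x = p * k :=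
    ⟨(Filter.eventually_cofinite.1 (eventually_forall_exists_siegelDelta_mul_localInt L e dV hdV hdV0 dW hdW hdW0)).toFinset, fun v hv => by
      by_contra h1
      exact hv ((Set.Finite.mem_toFinset _).2 h1)⟩
  obtain ⟨T₄, hT₄⟩ := exists_finset_evalPlace_mem_localInt L e dV hdV dW hdW h
  obtain ⟨T₅, hT₅⟩ := exists_finset_evalPlace_mem_localInt L e dV hdV dW hdW (weylDelta L e dV hdV dW hdW)
  obtain ⟨T₆, hT₆⟩ := exists_finset_forall_integral L S
  refine ⟨S₁ ∪ T₂ ∪ T₃ ∪ T₄ ∪ T₅ ∪ T₆, fun T hT => ?_⟩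
  have hS₁T : S₁ ⊆ T := fun v hv => hT (by simp only [Finset.mem_union]; exact Or.inl (Or.inl (Or.inl (Or.inl (Or.inl hv)))))
  have hχT : ∀ v, v ∉ T → ∀ w : UnitaryGroup.PlacesOver L v, χ.IsUnramifiedAt w.1 :=
    fun v hv => hT₂ v fun h2 => hv (hT (by simp only [Finset.mem_union]; exact Or.inl (Or.inl (Or.inl (Or.inl (Or.inr h2))))))
  have hIwT : ∀ v, v ∉ T → ∀ x : UnitaryGroup.localPi L (IsCMField.complexConj L) (n + n) (hermD L e dV hdV dW hdW) v,
      ∃ p ∈ siegelDeltaLoc L e dV hdV dW hdW v, ∃ k ∈ UnitaryGroup.localInt L (IsCMField.complexConj L) (n + n) (hermD L e dV hdV dW hdW) v, x = p * k :=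
    fun v hv => hT₃ v fun h3 => hv (hT (by simp only [Finset.mem_union]; exact Or.inl (Or.inl (Or.inl (Or.inr h3)))))
  have hhT : ∀ v, v ∉ T → UnitaryGroup.evalPlace (Fp L) L (IsCMField.complexConj L) (n + n) (hermD L e dV hdV dW hdW) v
      (UnitaryGroup.finPart (Fp L) L (IsCMField.complexConj L) (n + n) (hermD L e dV hdV dW hdW) h) ∈
        UnitaryGroup.localInt L (IsCMField.complexConj L) (n + n) (hermD L e dV hdV dW hdW) v :=
    fun v hv => hT₄ v fun h4 => hv (hT (by simp only [Finset.mem_union]; exact Or.inl (Or.inl (Or.inr h4))))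
  have hwT : ∀ v, v ∉ T → UnitaryGroup.evalPlace (Fp L) L (IsCMField.complexConj L) (n + n) (hermD L e dV hdV dW hdW) v
      (UnitaryGroup.finPart (Fp L) L (IsCMField.complexConj L) (n + n) (hermD L e dV hdV dW hdW) (weylDelta L e dV hdV dW hdW)) ∈
        UnitaryGroup.localInt L (IsCMField.complexConj L) (n + n) (hermD L e dV hdV dW hdW) v :=
    fun v hv => hT₅ v fun h5 => hv (hT (by simp only [Finset.mem_union]; exact Or.inl (Or.inr h5)))
  have hST : ∀ v, v ∉ T → ∀ (w : UnitaryGroup.PlacesOver L v) (i j : Fin n), ((S i j : L) : w.1.adicCompletion L) ∈ w.1.adicCompletionIntegers L :=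
    fun v hv => hT₆ v fun h6 => hv (hT (by simp only [Finset.mem_union]; exact Or.inr h6))
  -- ★ #31s: `f` factorises off `T` through its own slice values
  obtain ⟨-, hfac⟩ := stdFamilyFactorisable L e dV hdV hdV0 dW hdW hdW0 T χ hχT hIwT 𝒦 f hstd (hS₁ T hS₁T).1 0 (hS₁ T hS₁T).2
  exact ⟨hχT, hfac, hhT, hwT, hST⟩

/-! ## §2 ★ G1 applied at `(f, S, h)`: the Euler head of the `S`-th Whittaker coefficient of a standard family (carriers BY VALUE) -/

set_option maxHeartbeats 800000 in -- MEASURED: fails at 400 000 (`isDefEq` at the final `exact` of ★ G1), passes at 800 000 = ★ G1's own class and the template ★ (E3)'s; `obtain`∕`exact` only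
/-- **★ G1 AT THE SOCKET'S STANDARD FAMILY (index `S`), carriers by value.**  `𝒦` standard, `χ` UNITARY, `f` a `𝒦`-standard family with continuous members, `h ∈ H(𝔸)`,
`S ∈ M_n(L)`.  There is a finite `T₀` such that for every finite `T ⊇ T₀`, every Haar `νN` on `N_Δ(𝔸)`, local Haar measures `ν_v` pinned off `T` and archimedean carrier `ν_∞` with
the splitting `hmap` (★ Φ3b `exists_isHaarMeasure_map_unipDeltaSplit_eq_prod_pi_rpMeasure` — (2a), by name; or ★ (KW-car) for all `T` at once), for `n∕2 < re s`:
`W_S(f_s)(h) = (∫ [conj ψ_S(p_∞)·∏_{v∈T} conj ψ_S(ι_v p_v)]·f_s(placesEmbed_T(w_Δ p_∞ h_∞, (w_{Δ,v} p_v h_v)_{v∈T})) d(ν_∞ ⊗ ⨂_{v∈T} ν_v)) · ∏'_{v∉T} ∫ conj ψ_S(ι_v y)·Λ_{s,v}(w_{Δ,v} y) dν_v(y)`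
— ★ G1 with §1's letters and `hG` = ★ (x-c) `integrable_conj_unipDeltaChar_mul`; this is K1-a♮'s `hhead` surface. [cite: KudlaRallis1994, §1–§2] [cite: Tan1999, §2–§3]
[cite: Liu2011, §2B p. 862] [cite: CasselsFrohlichANT1967, Ch. XV (Tate) Lemma 3.2.1, Thm. 3.3.1] -/
theorem exists_eulerHead_whittakerDelta_of_isStandard (hdV0 : ∀ i, dV i ≠ 0) (hdW0 : ∀ i, dW i ≠ 0)
    [MeasurableSpace ↥(unipDelta L e dV hdV dW hdW)] [BorelSpace ↥(unipDelta L e dV hdV dW hdW)]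
    [MeasurableSpace ↥(unipDeltaArch L e dV hdV dW hdW)] [BorelSpace ↥(unipDeltaArch L e dV hdV dW hdW)]
    [∀ v : HeightOneSpectrum (𝓞 (Fp L)), MeasurableSpace ↥(unipDeltaLoc L e dV hdV dW hdW v)] [∀ v : HeightOneSpectrum (𝓞 (Fp L)), BorelSpace ↥(unipDeltaLoc L e dV hdV dW hdW v)]
    {𝒦 : IwasawaDatum L e dV hdV dW hdW} (h𝒦 : 𝒦.IsStd) {χ : HeckeCharacter L} (hχu : χ.IsUnitary)
    {f : ℂ → HA L e dV hdV dW hdW → ℂ} (hstd : IsStandardSectionFamily 𝒦 χ f) (hcont : ∀ s, Continuous (f s)) (h : HA L e dV hdV dW hdW)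
    (S : Matrix (Fin n) (Fin n) L) :
    ∃ T₀ : Finset (HeightOneSpectrum (𝓞 (Fp L))), ∀ T : Finset (HeightOneSpectrum (𝓞 (Fp L))), T₀ ⊆ T →
      ∀ (νN : Measure ↥(unipDelta L e dV hdV dW hdW))
        (νv : ∀ v : HeightOneSpectrum (𝓞 (Fp L)), Measure ↥(unipDeltaLoc L e dV hdV dW hdW v)) [∀ v, (νv v).IsHaarMeasure] [∀ v, SigmaFinite (νv v)],
        (∀ v, v ∉ T → νv v (((inH (fun v => UnitaryGroup.localInt L (IsCMField.complexConj L) (n + n) (hermD L e dV hdV dW hdW) v) (fun v => unipDeltaLoc L e dV hdV dW hdW v) v) : Subgroup ↥(unipDeltaLoc L e dV hdV dW hdW v)) : Set ↥(unipDeltaLoc L e dV hdV dW hdW v)) = 1) →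
        ∀ (νinf : Measure ↥(unipDeltaArch L e dV hdV dW hdW)) [SigmaFinite νinf] [νN.IsHaarMeasure],
          Measure.map (unipDeltaSplitAt L e dV hdV dW hdW T) νN =
            νinf.prod ((Measure.pi fun v : T => νv v.1).prod
              (rpMeasure (fun v : {v : HeightOneSpectrum (𝓞 (Fp L)) // v ∉ T} => ((inH (fun v => UnitaryGroup.localInt L (IsCMField.complexConj L) (n + n) (hermD L e dV hdV dW hdW) v) (fun v => unipDeltaLoc L e dV hdV dW hdW v) v.1 : Subgroup ↥(unipDeltaLoc L e dV hdV dW hdW v.1)) : Set ↥(unipDeltaLoc L e dV hdV dW hdW v.1))) (fun v => νv v.1) ∅)) →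
          ∀ s : ℂ, (n : ℝ) / 2 < s.re →
            whittakerDelta L e dV hdV dW hdW νN S (f s) h =
              (∫ p, (conj (unipDeltaChar L e dV hdV dW hdW S
                      (UnitaryGroup.archToAdelic (Fp L) L (IsCMField.complexConj L) (n + n) (hermD L e dV hdV dW hdW)
                        (p.1 : UnitaryGroup.arch (Fp L) L (IsCMField.complexConj L) (n + n) (hermD L e dV hdV dW hdW))) : ℂ) *
                    ∏ v : T, conj (unipDeltaChar L e dV hdV dW hdW S
                      (locToAdelic L e dV hdV dW hdW v.1
                        ((p.2 v : ↥(unipDeltaLoc L e dV hdV dW hdW v.1)) : UnitaryGroup.localPi L (IsCMField.complexConj L) (n + n) (hermD L e dV hdV dW hdW) v.1)) : ℂ)) *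
                  f s (placesEmbed L (hermD L e dV hdV dW hdW) T
                    (UnitaryGroup.archPart (Fp L) L (IsCMField.complexConj L) (n + n) (hermD L e dV hdV dW hdW) (weylDelta L e dV hdV dW hdW) *
                        (p.1 : UnitaryGroup.arch (Fp L) L (IsCMField.complexConj L) (n + n) (hermD L e dV hdV dW hdW)) *
                        UnitaryGroup.archPart (Fp L) L (IsCMField.complexConj L) (n + n) (hermD L e dV hdV dW hdW) h,
                      fun v : T => UnitaryGroup.evalPlace (Fp L) L (IsCMField.complexConj L) (n + n) (hermD L e dV hdV dW hdW) v.1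
                          (UnitaryGroup.finPart (Fp L) L (IsCMField.complexConj L) (n + n) (hermD L e dV hdV dW hdW) (weylDelta L e dV hdV dW hdW)) *
                        ((p.2 v : ↥(unipDeltaLoc L e dV hdV dW hdW v.1)) : UnitaryGroup.localPi L (IsCMField.complexConj L) (n + n) (hermD L e dV hdV dW hdW) v.1) *
                        UnitaryGroup.evalPlace (Fp L) L (IsCMField.complexConj L) (n + n) (hermD L e dV hdV dW hdW) v.1
                          (UnitaryGroup.finPart (Fp L) L (IsCMField.complexConj L) (n + n) (hermD L e dV hdV dW hdW) h)))
                ∂(νinf.prod (Measure.pi fun v : T => νv v.1))) *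
              ∏' v : {v : HeightOneSpectrum (𝓞 (Fp L)) // v ∉ T},
                ∫ y, conj (unipDeltaChar L e dV hdV dW hdW S
                      (locToAdelic L e dV hdV dW hdW v.1 (y : UnitaryGroup.localPi L (IsCMField.complexConj L) (n + n) (hermD L e dV hdV dW hdW) v.1)) : ℂ) *
                    LambdaLoc L e dV hdV dW hdW v.1 χ s
                      (UnitaryGroup.evalPlace (Fp L) L (IsCMField.complexConj L) (n + n) (hermD L e dV hdV dW hdW) v.1
                          (UnitaryGroup.finPart (Fp L) L (IsCMField.complexConj L) (n + n) (hermD L e dV hdV dW hdW) (weylDelta L e dV hdV dW hdW)) *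
                        (y : UnitaryGroup.localPi L (IsCMField.complexConj L) (n + n) (hermD L e dV hdV dW hdW) v.1)) ∂(νv v.1) := by
  obtain ⟨T₀, hT₀⟩ := exists_placeLetters_of_isStandard L e dV hdV dW hdW hdV0 hdW0 h𝒦 hstd hcont h S
  refine ⟨T₀, fun T hT νN νv _ _ hνK νinf _ _ hmap s hs => ?_⟩
  obtain ⟨hχT, hfac, hhT, hwT, hST⟩ := hT₀ T hT
  -- ★ (x-c): the twisted integrand is `L¹(νN)`; ★ G1 with all eleven letters
  exact (whittakerDelta_eq_mul_tprod_euler L e dV hdV dW hdW T νN νv hνK νinf hmap hχT hfac s S hhT hwT hST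
    (integrable_conj_unipDeltaChar_mul L e dV hdV dW hdW hdV0 hdW0 hχu hs (hstd.1.1 s) (hcont s) νN S h)).2

end Summit.HodgeConjecture.HodgeConjecture.Cruxes.HLiu418.K2LiuStdSectionPlaceLettersOfRecord

end
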